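import Summits.Ventures.PercRepro.RankDistBookPattern

/-!
# PercRepro — THE TWO SHADOW LEVELS OF THE BOOK AND THE FAILURE OF TOP (p9, gen 23)

On the tight layer `(k + 1, k)` of `B_k = book f hf`, with the bottom sets and the up-set of
`RankDistBookProfile` and the pattern counts of `RankDistBookPattern`:
* `mem_shadowLev_book_q_iff` / `card_shadowLev_book_q` — **`s_q = 2^k + k · 3^{k−1}`**: the rank-`k` members of the
  up-set are the transversals of the pairs and the sets `e₀ +` anything nonempty on all pairs but one;
* `mem_shadowLev_book_p_iff` / `card_shadowLev_book_p` — **`s_p = 2 · 3^k − 2^k`**: the spanning members are the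
  sets hitting every pair, with `e₀` or with a full pair;
* `card_shadowLev_book_p_lt_q` / `not_shadowCumulativeTop_book` — **TOP (`s_q ≤ s_p`) FAILS on `B_k` for every
  `k ≥ 6`** (`B_6`: `s_6 = 1522 > s_7 = 1394`), on a simple, loopless, coloop-free, connected graphic matroid; so the
  hypothesis TOP of the direct-sum closure `shadowCumulativeTop_disjointSum` cannot be dropped. `RankDistBookSum`
  turns this into the refutation of the row (SC) on `B_11 ⊕ B_12`. Nothing here moves any window of the crux.
-/

namespace PercRepro.RankDist

open Set Finset _root_.Matroid PercRepro.ThmH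

variable {α : Type} [DecidableEq α] {k : ℕ} (f : Option (Fin k × Bool) → α)

/-! ## The two levels -/

/-- The pattern predicate of the level `q`: no `e₀` and every page a singleton, or `e₀` and exactly one empty
page. -/
def BookQPred (ε : Bool) (g : Fin k → Finset Bool) : Prop :=
  (ε = false ∧ ∀ i, (g i).card = 1) ∨ (ε = true ∧ (Finset.univ.filter (fun i => g i = ∅)).card = 1)

/-- The pattern predicate of the level `p`: every page nonempty, and `e₀` or a full page. -/
def BookPPred (ε : Bool) (g : Fin k → Finset Bool) : Prop :=
  (∀ i, g i ≠ ∅) ∧ (ε = true ∨ ∃ i, g i = Finset.univ)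

/-- **The level `q = k` of the shadow**: a subset of `E` is a rank-`k` member of the up-set iff it is a transversal
of the pairs (no `e₀`, every page a singleton) or contains `e₀` and misses exactly one pair. -/
lemma mem_shadowLev_book_q_iff (hf : Function.Injective f) {A : Set α} :
    A ∈ shadowLev (book f hf) k (PerFlat.Uq (book f hf) (k + 1) k) ↔
      A ⊆ Set.range f ∧ ((bookSp f A = 0 ∧ bookFull f A = ∅ ∧ bookMiss f A = ∅) ∨
        (bookSp f A = 1 ∧ (bookMiss f A).card = 1)) := by
  rw [mem_shadowLev, book_ground]
  constructor
  · rintro ⟨hA, hrk, hup⟩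
    rw [exists_mem_Uq_subset_iff_book f hf hA] at hup
    rw [rk_book f hf hA] at hrk
    have hhm := card_bookHit_add_card_bookMiss f A
    have hsp := bookSp_le_one f A
    refine ⟨hA, ?_⟩
    rcases Nat.eq_zero_or_pos (bookMiss f A).card with h0 | hpos
    · left
      refine ⟨by omega, ?_, Finset.card_eq_zero.1 h0⟩
      rw [← Finset.card_eq_zero]; omega
    · right
      omega
  · rintro ⟨hA, h⟩
    have hhm := card_bookHit_add_card_bookMiss f A
    refine ⟨hA, ?_, ?_⟩
    · rw [rk_book f hf hA]
      rcases h with ⟨h0, hF, hM⟩ | ⟨h1, hM⟩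
      · have hF' : (bookFull f A).card = 0 := by rw [hF]; rfl
        have hM' : (bookMiss f A).card = 0 := by rw [hM]; rfl
        omega
      · omega
    · rw [exists_mem_Uq_subset_iff_book f hf hA]
      rcases h with ⟨h0, -, hM⟩ | ⟨h1, hM⟩
      · have hM' : (bookMiss f A).card = 0 := by rw [hM]; rfl
        omega
      · omega

/-- **The level `p = k + 1` of the shadow**: a subset of `E` is a spanning member of the up-set iff it hits every
pair and contains `e₀` or a full pair. -/
lemma mem_shadowLev_book_p_iff (hf : Function.Injective f) {A : Set α} :
    A ∈ shadowLev (book f hf) (k + 1) (PerFlat.Uq (book f hf) (k + 1) k) ↔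
      A ⊆ Set.range f ∧ bookMiss f A = ∅ ∧ (bookSp f A = 1 ∨ bookFull f A ≠ ∅) := by
  rw [mem_shadowLev, book_ground]
  constructor
  · rintro ⟨hA, hrk, -⟩
    rw [rk_book f hf hA] at hrk
    have hhm := card_bookHit_add_card_bookMiss f A
    have hsp := bookSp_le_one f A
    have hM : (bookMiss f A).card = 0 := by omega
    refine ⟨hA, Finset.card_eq_zero.1 hM, ?_⟩
    rcases Nat.eq_zero_or_pos (bookSp f A) with h0 | h1
    · right
      rw [← Finset.nonempty_iff_ne_empty, ← Finset.card_pos]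
      omega
    · left; omega
  · rintro ⟨hA, hM, h⟩
    have hhm := card_bookHit_add_card_bookMiss f A
    have hM' : (bookMiss f A).card = 0 := by rw [hM]; rfl
    refine ⟨hA, ?_, ?_⟩
    · rw [rk_book f hf hA]
      rcases h with h1 | hF
      · omega
      · have := Finset.card_pos.2 (Finset.nonempty_iff_ne_empty.2 hF)
        omega
    · rw [exists_mem_Uq_subset_iff_book f hf hA]
      omega

/-- A filter of `univ` is empty iff the predicate never holds. -/
lemma filter_univ_eq_empty_iff {p : Fin k → Prop} [DecidablePred p] :
    Finset.univ.filter p = ∅ ↔ ∀ i, ¬ p i := by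
  simp [Finset.eq_empty_iff_forall_notMem]

omit [DecidableEq α] in
open scoped Classical in
/-- The level-`q` conditions in pattern terms. -/
lemma bookQPred_iff {A : Set α} :
    BookQPred (decide (f none ∈ A)) (bookPg f A) ↔
      (bookSp f A = 0 ∧ bookFull f A = ∅ ∧ bookMiss f A = ∅) ∨ (bookSp f A = 1 ∧ (bookMiss f A).card = 1) := by
  unfold BookQPred
  rw [bookSp_eq_zero_iff_decide, bookSp_eq_one_iff_decide, bookMiss_eq_filter_pg, bookFull_eq_filter_pg,
    filter_univ_eq_empty_iff, filter_univ_eq_empty_iff]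
  apply or_congr_left
  apply and_congr_right
  intro _
  constructor
  · intro h
    exact ⟨fun i => ((card_eq_one_iff_finset_bool _).1 (h i)).2,
      fun i => ((card_eq_one_iff_finset_bool _).1 (h i)).1⟩
  · rintro ⟨h1, h2⟩ i
    exact (card_eq_one_iff_finset_bool _).2 ⟨h2 i, h1 i⟩

omit [DecidableEq α] in
open scoped Classical in
/-- The level-`p` conditions in pattern terms. -/
lemma bookPPred_iff {A : Set α} :
    BookPPred (decide (f none ∈ A)) (bookPg f A) ↔
      bookMiss f A = ∅ ∧ (bookSp f A = 1 ∨ bookFull f A ≠ ∅) := by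
  unfold BookPPred
  rw [bookSp_eq_one_iff_decide, bookMiss_eq_filter_pg, bookFull_eq_filter_pg, filter_univ_eq_empty_iff,
    ← Finset.nonempty_iff_ne_empty, Finset.filter_nonempty_iff]
  simp only [Finset.mem_univ, true_and]

open scoped Classical in
/-- The level-`q` patterns with `e₀`: `k · 3^{k−1}`. -/
lemma card_bookQPred_true :
    ((Finset.univ : Finset (Fin k → Finset Bool)).filter (fun g => BookQPred true g)).card = k * 3 ^ (k - 1) := by
  have e : (Finset.univ : Finset (Fin k → Finset Bool)).filter (fun g => BookQPred true g)
      = (Finset.univ : Finset (Fin k → Finset Bool)).filter (fun g => (Finset.univ.filter (fun i => g i = ∅)).card = 1) := by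
    ext g
    simp [BookQPred]
  rw [e, card_pg_one_empty]

open scoped Classical in
/-- The level-`q` patterns without `e₀`: `2^k`. -/
lemma card_bookQPred_false :
    ((Finset.univ : Finset (Fin k → Finset Bool)).filter (fun g => BookQPred false g)).card = 2 ^ k := by
  have e : (Finset.univ : Finset (Fin k → Finset Bool)).filter (fun g => BookQPred false g)
      = (Finset.univ : Finset (Fin k → Finset Bool)).filter (fun g => ∀ i, (g i).card = 1) := by
    ext g
    simp [BookQPred]
  rw [e, card_pg_singleton]

open scoped Classical in
/-- The level-`p` patterns with `e₀`: `3^k`. -/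
lemma card_bookPPred_true :
    ((Finset.univ : Finset (Fin k → Finset Bool)).filter (fun g => BookPPred true g)).card = 3 ^ k := by
  have e : (Finset.univ : Finset (Fin k → Finset Bool)).filter (fun g => BookPPred true g)
      = (Finset.univ : Finset (Fin k → Finset Bool)).filter (fun g => ∀ i, g i ≠ ∅) := by
    ext g
    simp [BookPPred]
  rw [e, card_pg_nonempty]

open scoped Classical in
/-- The level-`p` patterns without `e₀`: `3^k − 2^k`. -/
lemma card_bookPPred_false :
    ((Finset.univ : Finset (Fin k → Finset Bool)).filter (fun g => BookPPred false g)).card = 3 ^ k - 2 ^ k := by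
  have e : (Finset.univ : Finset (Fin k → Finset Bool)).filter (fun g => BookPPred false g)
      = (Finset.univ : Finset (Fin k → Finset Bool)).filter (fun g => (∀ i, g i ≠ ∅) ∧ ∃ i, g i = Finset.univ) := by
    ext g
    simp [BookPPred]
  rw [e, card_pg_nonempty_full]

/-- **`s_q(B_k) = 2^k + k · 3^{k−1}`**. -/
theorem card_shadowLev_book_q (hf : Function.Injective f) :
    (shadowLev (book f hf) k (PerFlat.Uq (book f hf) (k + 1) k)).card = 2 ^ k + k * 3 ^ (k - 1) := by
  classical
  have e : shadowLev (book f hf) k (PerFlat.Uq (book f hf) (k + 1) k)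
      = (subsetsFin (book f hf)).filter (fun A => BookQPred (decide (f none ∈ A)) (bookPg f A)) := by
    ext A
    rw [mem_shadowLev_book_q_iff f hf, Finset.mem_filter, mem_subsetsFin, book_ground, bookQPred_iff]
  rw [e, card_filter_book f hf BookQPred, card_filter_bool_prod BookQPred, card_bookQPred_true,
    card_bookQPred_false]
  ring

/-- **`s_p(B_k) = 2 · 3^k − 2^k`**. -/
theorem card_shadowLev_book_p (hf : Function.Injective f) :
    (shadowLev (book f hf) (k + 1) (PerFlat.Uq (book f hf) (k + 1) k)).card = 2 * 3 ^ k - 2 ^ k := by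
  classical
  have e : shadowLev (book f hf) (k + 1) (PerFlat.Uq (book f hf) (k + 1) k)
      = (subsetsFin (book f hf)).filter (fun A => BookPPred (decide (f none ∈ A)) (bookPg f A)) := by
    ext A
    rw [mem_shadowLev_book_p_iff f hf, Finset.mem_filter, mem_subsetsFin, book_ground, bookPPred_iff]
  rw [e, card_filter_book f hf BookPPred, card_filter_bool_prod BookPPred, card_bookPPred_true,
    card_bookPPred_false]
  have : 2 ^ k ≤ 3 ^ k := Nat.pow_le_pow_left (by norm_num) k
  omega

/-! ## TOP fails on the books -/

/-- **TOP fails on `B_k` for every `k ≥ 6`**: `s_q > s_p`. -/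
theorem card_shadowLev_book_p_lt_q (hf : Function.Injective f) (hk : 6 ≤ k) :
    (shadowLev (book f hf) (k + 1) (PerFlat.Uq (book f hf) (k + 1) k)).card
      < (shadowLev (book f hf) k (PerFlat.Uq (book f hf) (k + 1) k)).card := by
  rw [card_shadowLev_book_p, card_shadowLev_book_q]
  obtain ⟨m, rfl⟩ : ∃ m, k = m + 6 := ⟨k - 6, by omega⟩
  have h3 : 3 ^ (m + 6) = 3 * 3 ^ (m + 6 - 1) := by
    rw [show m + 6 - 1 = m + 5 from rfl]; ring
  have h6 : 6 * 3 ^ (m + 6 - 1) ≤ (m + 6) * 3 ^ (m + 6 - 1) := Nat.mul_le_mul_right _ (by omega)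
  have h2pos : 0 < 2 ^ (m + 6) := Nat.two_pow_pos _
  have h2 : 2 ^ (m + 6) ≤ 3 ^ (m + 6 - 1) := by
    rw [show m + 6 - 1 = m + 5 from rfl]
    calc 2 ^ (m + 6) = 2 * 2 ^ (m + 5) := by rw [pow_succ]; ring
      _ ≤ 3 ^ (m + 5) := by
          have := Nat.pow_le_pow_left (show 2 ≤ 3 by norm_num) (m + 5)
          have h5 : 2 ^ 5 ≤ 2 ^ (m + 5) := Nat.pow_le_pow_right (by norm_num) (by omega)
          have h35 : 3 ^ (m + 5) = 3 ^ m * 243 := by rw [pow_add]; norm_num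
          have h25 : 2 ^ (m + 5) = 2 ^ m * 32 := by rw [pow_add]; norm_num
          have hm : 2 ^ m ≤ 3 ^ m := Nat.pow_le_pow_left (by norm_num) m
          rw [h35, h25]
          nlinarith
  omega

/-- **`ShadowCumulativeTop` fails on `B_k` for every `k ≥ 6`** (its clause `v = p`). -/
theorem not_shadowCumulativeTop_book (hf : Function.Injective f) (hk : 6 ≤ k) :
    ¬ ShadowCumulativeTop (book f hf) (k + 1) k := by
  intro h
  have h1 := h (k + 1) (by omega) le_rfl
  rw [Nat.choose_symm_add] at h1
  have h2 := card_shadowLev_book_p_lt_q f hf hk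
  have hpos : 0 < ((k + 1) + k).choose k := Nat.choose_pos (by omega)
  have := lt_of_lt_of_le (Nat.mul_lt_mul_of_pos_right h2 hpos) h1
  exact lt_irrefl _ this

end PercRepro.RankDist
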